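import Mathlib
import Summits.ValiantsHypothesis.ValiantsHypothesis.Theorems.SymPencilEquivariantSdcNotQPPermEmbeddingRegular
import HarnessLib

/-!
# ValiantsHypothesis / SymPencil — crux `EquivariantSdcNotQP` (stmt-ValiantsHypothesis-17792),
# line `birth_EquivariantSdcNotQP`, stub `stub_permify`, piece (iii′) `PermEmbeddingQP`:
# typed reduction to INVARIANT FUNCTIONALS OF SMALL-INDEX SUBGROUPS (helper)

Piece (iii′) asks for the `F`-module `ℂ^{m₀}` (`F ≤ (𝔖_n × 𝔖_n) × GL_{m₀}(ℂ)` a lift group with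
scalar unimodular fibre) to be an equivariant retract of a permutation module of quasi-polynomial
dimension.  `permEmbedding_of_invariant_functionals` strips all matrix bookkeeping from it:

**if** there are finitely many pairs `(H_k, w_k)` — `H_k ≤ F` a subgroup and `w_k ∈ (ℂ^{m₀})^*` a
functional invariant under `H_k` (`w_k g_h = w_k`) — whose `F`-orbits SEPARATE `ℂ^{m₀}`
(`w_k(g_x v) = 0` for all `k`, `x ∈ F` forces `v = 0`), **then** `ℂ^{m₀}` is an equivariant
retract of the permutation module `⊕_k ℂ[F/H_k]` of dimension `∑_k [F : H_k]`:
`ι v = (w_k(g_f⁻¹ v))_{(k, fH_k)}`, `τ_x` = left translation by `x⁻¹` on cosets, and `p` = the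
average over `F` of `g_f L P_{τ f}⁻¹` for any left inverse `L` of `ι`.

So (iii′) ⇐ «for lift groups `F`, the dual of `ℂ^{m₀}` is spanned by the `F`-orbits of functionals
invariant under subgroups of total index `≤ 2^{(log₂ m₀ + log₂ n + d)^d}`» — pure representation
theory of `𝔖_n × 𝔖_n` and its central extensions (Maschke + Young's rule `S^λ ↪ M^λ` + degree
bounds), which is where the line card places the difficulty.  `…PermEmbeddingRegular.lean` is the
instance `K = [m₀]`, `H_k = 1`, `w_k = e_k^*` (cost `m₀ · |F|`).

Honest framing: a reduction; (iii′), `stub_permify`, the crux and `VP ≠ VNP` remain OPEN.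
Helper (`--supports stmt-ValiantsHypothesis-17792 --as helper`); 0 definitions, 0 named facts.
-/

noncomputable section

set_option linter.dupNamespace false

namespace Summit.ValiantsHypothesis.ValiantsHypothesis.Theorems.SymPencilEquivariantSdcNotQP.PermEmbedding

open Matrix

variable {n m₀ : ℕ}

/-- A lift group with scalar unimodular fibre is finite (also for `m₀ = 0`). [folklore] -/
theorem finite_liftGroup (F : Subgroup ((Equiv.Perm (Fin n) × Equiv.Perm (Fin n)) × GL (Fin m₀) ℂ))
    (hscal : ∀ g : GL (Fin m₀) ℂ, ((1 : Equiv.Perm (Fin n) × Equiv.Perm (Fin n)), g) ∈ F →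
      ∃ c : ℂ, (g : Matrix (Fin m₀) (Fin m₀) ℂ) = c • (1 : Matrix (Fin m₀) (Fin m₀) ℂ))
    (hdet : ∀ x ∈ F, Matrix.det (x.2 : Matrix (Fin m₀) (Fin m₀) ℂ) = 1) : Finite F := by
  rcases Nat.eq_zero_or_pos m₀ with rfl | hm₀
  · haveI : Finite (Matrix (Fin 0) (Fin 0) ℂ) := by
      haveI : Subsingleton (Matrix (Fin 0) (Fin 0) ℂ) := ⟨fun a b => by ext i; exact Fin.elim0 i⟩
      infer_instance
    haveI : Finite (GL (Fin 0) ℂ) := Finite.of_injective _ Units.val_injective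
    infer_instance
  · exact (card_liftGroup_le hm₀ F hscal hdet).1

/-- A row of a product: `(A * B) a = A a ᵥ* B`. [folklore] -/
theorem mul_apply_eq_vecMul {l m k : Type*} [Fintype m] (A : Matrix l m ℂ) (B : Matrix m k ℂ)
    (a : l) : (A * B) a = A a ᵥ* B := by
  funext j
  simp [Matrix.mul_apply, Matrix.vecMul, dotProduct]

/-- **Permutation embedding from invariant functionals** (typed reduction of piece (iii′)
`PermEmbeddingQP`).  Let `F ≤ (𝔖_n × 𝔖_n) × GL_{m₀}(ℂ)` be a lift group (scalar unimodular fibre)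
and let `(H_k, w_k)_{k ∈ K}` be finitely many subgroups `H_k ≤ F` with `H_k`-invariant functionals
`w_k` (`w_k g_h = w_k` for `h ∈ H_k`) whose `F`-orbits separate `ℂ^{m₀}`.  Then `ℂ^{m₀}` is an
equivariant retract — in the exact currency of (iii′): `p ι = 1`, `P_τ ι = ι g`, `p P_τ = g p` —
of a permutation module of dimension `m' = ∑_k [F : H_k]` (the cosets `⊔_k F/H_k` with left
translation). [folklore] -/
theorem permEmbedding_of_invariant_functionals
    (F : Subgroup ((Equiv.Perm (Fin n) × Equiv.Perm (Fin n)) × GL (Fin m₀) ℂ))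
    (hscal : ∀ g : GL (Fin m₀) ℂ, ((1 : Equiv.Perm (Fin n) × Equiv.Perm (Fin n)), g) ∈ F →
      ∃ c : ℂ, (g : Matrix (Fin m₀) (Fin m₀) ℂ) = c • (1 : Matrix (Fin m₀) (Fin m₀) ℂ))
    (hdet : ∀ x ∈ F, Matrix.det (x.2 : Matrix (Fin m₀) (Fin m₀) ℂ) = 1)
    {K : Type} [Fintype K] (H : K → Subgroup F) (w : K → Fin m₀ → ℂ)
    (hw : ∀ k, ∀ h ∈ H k, (w k) ᵥ*
      (((h : (Equiv.Perm (Fin n) × Equiv.Perm (Fin n)) × GL (Fin m₀) ℂ).2 : GL (Fin m₀) ℂ) :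
        Matrix (Fin m₀) (Fin m₀) ℂ) = w k)
    (hsep : ∀ v : Fin m₀ → ℂ,
      (∀ k, ∀ x ∈ F, w k ⬝ᵥ ((x.2 : Matrix (Fin m₀) (Fin m₀) ℂ) *ᵥ v) = 0) → v = 0) :
    ∃ m', m' = ∑ k, (H k).index ∧
      ∃ (ι : Matrix (Fin m') (Fin m₀) ℂ) (p : Matrix (Fin m₀) (Fin m') ℂ)
        (τ : (Equiv.Perm (Fin n) × Equiv.Perm (Fin n)) × GL (Fin m₀) ℂ → Equiv.Perm (Fin m')),
        p * ι = 1 ∧ ∀ x ∈ F,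
          (τ x).permMatrix ℂ * ι = ι * (x.2 : Matrix (Fin m₀) (Fin m₀) ℂ) ∧
          p * (τ x).permMatrix ℂ = (x.2 : Matrix (Fin m₀) (Fin m₀) ℂ) * p := by
  classical
  haveI : Finite F := finite_liftGroup F hscal hdet
  letI : Fintype F := Fintype.ofFinite F
  set N : ℕ := Fintype.card F with hN
  have hN0 : (N : ℂ) ≠ 0 := by exact_mod_cast Fintype.card_ne_zero
  -- the matrices attached to an element of `F`
  let g : F → Matrix (Fin m₀) (Fin m₀) ℂ := fun f =>
    (((f : (Equiv.Perm (Fin n) × Equiv.Perm (Fin n)) × GL (Fin m₀) ℂ).2 : GL (Fin m₀) ℂ) :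
      Matrix (Fin m₀) (Fin m₀) ℂ)
  let gi : F → Matrix (Fin m₀) (Fin m₀) ℂ := fun f =>
    ((((f : (Equiv.Perm (Fin n) × Equiv.Perm (Fin n)) × GL (Fin m₀) ℂ).2)⁻¹ : GL (Fin m₀) ℂ) :
      Matrix (Fin m₀) (Fin m₀) ℂ)
  have hggi : ∀ f, g f * gi f = 1 := fun f => Units.mul_inv _
  have hg_mul : ∀ f f' : F, g (f * f') = g f * g f' := fun f f' => by
    simp only [g, Subgroup.coe_mul, Prod.snd_mul, Units.val_mul]
  have hgi_mul : ∀ f f' : F, gi (f * f') = gi f' * gi f := fun f f' => by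
    simp only [gi, Subgroup.coe_mul, Prod.snd_mul, _root_.mul_inv_rev, Units.val_mul]
  have hgi_inv : ∀ f : F, gi f⁻¹ = g f := fun f => by
    simp only [gi, g, Subgroup.coe_inv, Prod.snd_inv, inv_inv]
  -- invariance transported to `gi`
  have hw' : ∀ k, ∀ h ∈ H k, (w k) ᵥ* gi h = w k := by
    intro k h hh
    have := hw k h hh
    calc (w k) ᵥ* gi h = ((w k) ᵥ* g h) ᵥ* gi h := by rw [this]
      _ = w k := by rw [Matrix.vecMul_vecMul, hggi, Matrix.vecMul_one]
  -- the permutation module: cosets `⊔_k F/H_k`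
  let Q : K → Type := fun k => F ⧸ H k
  letI : ∀ k, Fintype (Q k) := fun k => Fintype.ofFinite _
  let X := Σ k, Q k
  let e : X ≃ Fin (Fintype.card X) := Fintype.equivFin X
  have hcardX : Fintype.card X = ∑ k, (H k).index := by
    simp only [X, Fintype.card_sigma]
    refine Finset.sum_congr rfl fun k _ => ?_
    rw [Subgroup.index_eq_card, Nat.card_eq_fintype_card]
  -- the row attached to a coset
  let row : (k : K) → Q k → (Fin m₀ → ℂ) := fun k =>
    Quotient.lift (fun f : F => (w k) ᵥ* gi f) (by
      intro f f' hff'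
      have hmem : f⁻¹ * f' ∈ H k := QuotientGroup.leftRel_apply.mp hff'
      have hf' : f' = f * (f⁻¹ * f') := by group
      show (w k) ᵥ* gi f = (w k) ᵥ* gi f'
      rw [hf', hgi_mul, ← Matrix.vecMul_vecMul, hw' k _ hmem])
  -- the permutation action: left translation by `y⁻¹`
  let σ : F → Equiv.Perm (Fin (Fintype.card X)) := fun y =>
    (e.symm.trans (Equiv.sigmaCongrRight fun k => (MulAction.toPerm (y⁻¹ : F) : Equiv.Perm (Q k))))
      |>.trans e
  have hσ : ∀ y a, e.symm (σ y a) = ⟨(e.symm a).1, (y⁻¹ : F) • (e.symm a).2⟩ := by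
    intro y a
    simp [σ, Equiv.sigmaCongrRight]
  have hσ_mul : ∀ y y' : F, σ (y * y') = σ y' * σ y := by
    intro y y'
    ext a : 1
    apply e.symm.injective
    rw [Equiv.Perm.mul_apply, hσ, hσ, hσ]
    simp only [_root_.mul_inv_rev, mul_smul]
  have hσ_one : σ 1 = 1 := by
    ext a : 1
    apply e.symm.injective
    rw [hσ]
    simp
  have hσ_inv : ∀ y : F, σ y⁻¹ = (σ y)⁻¹ := by
    intro y
    have h := hσ_mul y y⁻¹
    rw [mul_inv_cancel, hσ_one] at h
    exact (eq_inv_of_mul_eq_one_left h.symm)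
  have hP_mul : ∀ y y' : F, (σ (y * y')).permMatrix ℂ = (σ y).permMatrix ℂ * (σ y').permMatrix ℂ := by
    intro y y'
    rw [hσ_mul, Matrix.permMatrix_mul]
  have hP_inv : ∀ y : F, (σ y⁻¹).permMatrix ℂ = ((σ y).permMatrix ℂ)ᵀ := by
    intro y
    rw [hσ_inv, Matrix.transpose_permMatrix]
  -- `ι`
  let ι : Matrix (Fin (Fintype.card X)) (Fin m₀) ℂ :=
    Matrix.of fun a j => row (e.symm a).1 (e.symm a).2 j
  have hι_equiv : ∀ y : F, (σ y).permMatrix ℂ * ι = ι * g y := by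
    intro y
    have key : ∀ a, ι (σ y a) = ι a ᵥ* g y := by
      intro a
      change (fun j => row (e.symm (σ y a)).1 (e.symm (σ y a)).2 j) =
        (fun j => row (e.symm a).1 (e.symm a).2 j) ᵥ* g y
      rw [hσ]
      generalize e.symm a = kq
      obtain ⟨k, q⟩ := kq
      dsimp only
      induction q using QuotientGroup.induction_on with
      | H f =>
        rw [MulAction.Quotient.smul_coe, smul_eq_mul]
        change (fun j => ((w k) ᵥ* gi (y⁻¹ * f)) j) = (fun j => ((w k) ᵥ* gi f) j) ᵥ* g y
        rw [hgi_mul, hgi_inv, ← Matrix.vecMul_vecMul]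
    rw [Equiv.Perm.permMatrix, PEquiv.toMatrix_toPEquiv_mul]
    ext a j
    rw [Matrix.submatrix_apply, id, mul_apply_eq_vecMul, key]
  have hg_inv : ∀ f : F, g f⁻¹ = gi f := fun f => by rw [← hgi_inv, inv_inv]
  -- `ι` is injective, hence has a left inverse
  have hι_inj : ∀ v, ι *ᵥ v = 0 → v = 0 := by
    intro v hv
    apply hsep
    intro k x hx
    have h := congr_fun hv (e ⟨k, QuotientGroup.mk (⟨x, hx⟩⁻¹ : F)⟩)
    change ι (e ⟨k, QuotientGroup.mk (⟨x, hx⟩⁻¹ : F)⟩) ⬝ᵥ v = 0 at h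
    have hιrow : ι (e ⟨k, QuotientGroup.mk (⟨x, hx⟩⁻¹ : F)⟩) = (w k) ᵥ* g ⟨x, hx⟩ := by
      funext j
      change row (e.symm (e ⟨k, QuotientGroup.mk (⟨x, hx⟩⁻¹ : F)⟩)).1
        (e.symm (e ⟨k, QuotientGroup.mk (⟨x, hx⟩⁻¹ : F)⟩)).2 j = _
      rw [Equiv.symm_apply_apply]
      change ((w k) ᵥ* gi (⟨x, hx⟩⁻¹ : F)) j = _
      rw [hgi_inv]
    rw [hιrow, ← Matrix.dotProduct_mulVec] at h
    exact h
  obtain ⟨Lm, hLm⟩ : ∃ Lm : Matrix (Fin m₀) (Fin (Fintype.card X)) ℂ, Lm * ι = 1 := by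
    have hker : LinearMap.ker (Matrix.toLin' ι) = ⊥ := by
      rw [LinearMap.ker_eq_bot']
      intro v hv
      exact hι_inj v (by rwa [Matrix.toLin'_apply] at hv)
    obtain ⟨L, hL⟩ := LinearMap.exists_leftInverse_of_injective _ hker
    refine ⟨LinearMap.toMatrix' L, ?_⟩
    rw [← LinearMap.toMatrix'_toLin' ι, ← LinearMap.toMatrix'_comp, hL, LinearMap.toMatrix'_id]
  -- `p`: the average of `g_f L P_{σ f}ᵀ`
  let p : Matrix (Fin m₀) (Fin (Fintype.card X)) ℂ :=
    (N : ℂ)⁻¹ • ∑ f : F, g f * Lm * ((σ f).permMatrix ℂ)ᵀ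
  let τ : (Equiv.Perm (Fin n) × Equiv.Perm (Fin n)) × GL (Fin m₀) ℂ →
      Equiv.Perm (Fin (Fintype.card X)) :=
    fun x => if hx : x ∈ F then σ ⟨x, hx⟩ else 1
  have hPP : ∀ y : F, ((σ y).permMatrix ℂ)ᵀ * (σ y).permMatrix ℂ = 1 := by
    intro y
    rw [← hP_inv, ← hP_mul, inv_mul_cancel, hσ_one, Matrix.permMatrix_one]
  refine ⟨Fintype.card X, hcardX, ι, p, τ, ?_, fun x hx => ?_⟩
  · -- `p ι = 1`
    simp only [p, Matrix.smul_mul, Matrix.sum_mul]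
    have hterm : ∀ f : F, g f * Lm * ((σ f).permMatrix ℂ)ᵀ * ι = 1 := by
      intro f
      rw [← hP_inv, Matrix.mul_assoc, hι_equiv, hg_inv, ← Matrix.mul_assoc,
        Matrix.mul_assoc (g f) Lm ι, hLm, Matrix.mul_one, hggi]
    simp only [hterm, Finset.sum_const, Finset.card_univ]
    rw [← hN, ← Nat.cast_smul_eq_nsmul ℂ, smul_smul, inv_mul_cancel₀ hN0, one_smul]
  · have hτ : τ x = σ ⟨x, hx⟩ := dif_pos hx
    rw [hτ]
    refine ⟨hι_equiv ⟨x, hx⟩, ?_⟩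
    -- `p P_{σ y} = g_y p`: reindex the average by `f ↦ y f`
    set y : F := ⟨x, hx⟩ with hy
    change p * (σ y).permMatrix ℂ = g y * p
    simp only [p, Matrix.smul_mul, Matrix.mul_smul, Matrix.sum_mul, Matrix.mul_sum]
    congr 1
    refine (Fintype.sum_equiv (Equiv.mulLeft y) _ _ fun f => ?_).symm
    simp only [Equiv.coe_mulLeft]
    rw [hg_mul, hP_mul, Matrix.transpose_mul]
    simp only [Matrix.mul_assoc]
    rw [hPP, Matrix.mul_one]

end Summit.ValiantsHypothesis.ValiantsHypothesis.Theorems.SymPencilEquivariantSdcNotQP.PermEmbedding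

end
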